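import Mathlib
import Literature.Analysis.FluidPDE.Tao2016AveragedNS.ShiftSetCascadeFlows
import Summits.NavierStokesRegularity.NavierStokesRegularity.Theorems.TaoLadderRungTwoFlatCertificateGlueTruncFlowOn
import HarnessLib

/-!
# Certificate glue on a shift set `𝕊`, XVII: THE ANALYTIC ONE-STEP CERTIFICATE — `StepCert` for a short step from
  TABLE INEQUALITIES ONLY (method of majorants + Grönwall), no enclosure hypothesis left
  (helper for items stmt-NavierStokesRegularity-22987 `FlatGapCertificatesV2` and stmt-24295 K_A₂(64);
  cell harvest/h2-tao-ladder, p1 g14)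

`stepCert_of_majorant`: for a mesh step of length `h` with the majorant guard `b·m₀·h < 1`, a node set inside the
weighted ball of radius `m₀`, the (B)-table bound `b` of the structure table (`Σ|α| c ω̂_a ω̂_b ≤ b ω_k`), a region
radius `R ≥ m₀/(1 − b m₀ h)` dominating the a priori `M`-box, the input-defect bound `δ` on that region
(`InputDefectOn`, itself a table inequality by glue XV) and the Grönwall allowance `gronwallBound 0 (2bR) δ h ≤ A`:
the ONE-STEP CERTIFICATE `StepCert j` holds with hull / next node = the weighted ball of radius
`m₀/(1 − b m₀ h) + A`. Ingredients: glue XVI (`exists_truncFlow_majorant`: the exact truncated flow with the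
Cauchy-majorant bound), glue XV (`fieldLipOn_of_table`: Lipschitz constant `2bR` on the ball of radius `R`), glue XIV
(`stepCert_of_flowStep`). This is the kernel-complete, numerics-free base case of the certificate pipeline: chained
along a mesh (glue X) it certifies trapping/landing over times of order `1/(b m₀)` — short of a hop (the majorant
blows up), which is why sharper (Taylor-model) step enclosures remain the route for the recurrent box; but every
hypothesis of the A♭ / A₂(64) chain is now discharged in the kernel for SOME certificate.

HONEST FRAMING: Tao-type MODEL lattices (Tao 2016 §4/§6 vocabulary, shift-set parametrised); an a priori estimate
for a finite-dimensional polynomial ODE — nothing certified about any particular table, no stub closed, nothing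
about the Navier–Stokes equations.
-/

noncomputable section

-- the sub-problem namespace repeats the summit name by design (D-0017)
set_option linter.dupNamespace false

namespace Summit.NavierStokesRegularity.NavierStokesRegularity.Theorems

open Set Finset Literature.Analysis.FluidPDE Literature.Analysis.FluidPDE.TaoCascade

namespace CertificateGlueOn

variable {m : ℕ} {𝕊 : Finset (ℤ × ℤ × ℤ)} {ε₀ : ℝ} {α : Fin m → Fin m → Fin m → ℤ × ℤ × ℤ → ℝ} {Kb Ka : ℤ}
  {Eb Et : ℝ} {ω : ℤ → ℝ}

/-- The box sup bound of the weighted ball of radius `R` is `R ω̂`. [folklore] -/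
theorem boxSup_ball (hω : ∀ k, 0 < ω k) {R : ℝ} (hR : 0 ≤ R) (i : Fin m) (n : ℤ) :
    boxSup Kb Ka (fun _ k => -(R * ω k)) (fun _ k => R * ω k) i n = R * wExt Kb Ka ω n := by
  unfold boxSup wExt
  split_ifs with hn
  · have h0 : 0 ≤ R * ω n := mul_nonneg hR (hω n).le
    rw [abs_neg, abs_of_nonneg h0, max_self]
  · simp

/-- **Lipschitz constant `2bR` of the truncated field on the weighted ball of radius `R`** from the (B)-table bound.
[cite: MooreKearfottCloud2009, §6.2–6.4 (interval enclosures of ranges); cell certificate format, box layer] -/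
theorem fieldLipOn_ball (hε : 0 < 1 + ε₀) (hω : ∀ k, 0 < ω k) {b R : ℝ} (hR : 0 ≤ R)
    (hB : ∀ i k, -Kb ≤ k → k ≤ Ka →
      ∑ i₁ : Fin m, ∑ i₂ : Fin m, ∑ μ ∈ 𝕊,
        |α i₁ i₂ i μ| * (1 + ε₀) ^ ((5 : ℝ) * (k - μ.2.2) / 2) *
          (wExt Kb Ka ω (k - μ.2.2 + μ.1) * wExt Kb Ka ω (k - μ.2.2 + μ.2.1)) ≤ b * ω k) :
    FieldLipOn 𝕊 ε₀ α Kb Ka ω (fun _ k => -(R * ω k)) (fun _ k => R * ω k) (2 * b * R) := by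
  refine fieldLipOn_of_table hε (fun k => (hω k).le) fun i k hk1 hk2 => ?_
  have key : ∀ (i₁ i₂ : Fin m) (μ : ℤ × ℤ × ℤ),
      |α i₁ i₂ i μ| * (1 + ε₀) ^ ((5 : ℝ) * (k - μ.2.2) / 2) *
          (boxSup Kb Ka (fun _ k => -(R * ω k)) (fun _ k => R * ω k) i₁ (k - μ.2.2 + μ.1) *
              wExt Kb Ka ω (k - μ.2.2 + μ.2.1) +
            wExt Kb Ka ω (k - μ.2.2 + μ.1) *
              boxSup Kb Ka (fun _ k => -(R * ω k)) (fun _ k => R * ω k) i₂ (k - μ.2.2 + μ.2.1)) =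
        2 * R * (|α i₁ i₂ i μ| * (1 + ε₀) ^ ((5 : ℝ) * (k - μ.2.2) / 2) *
          (wExt Kb Ka ω (k - μ.2.2 + μ.1) * wExt Kb Ka ω (k - μ.2.2 + μ.2.1))) := by
    intro i₁ i₂ μ
    rw [boxSup_ball hω hR, boxSup_ball hω hR]
    ring
  calc _ = ∑ i₁ : Fin m, ∑ i₂ : Fin m, ∑ μ ∈ 𝕊, 2 * R * (|α i₁ i₂ i μ| * (1 + ε₀) ^ ((5 : ℝ) * (k - μ.2.2) / 2) *
          (wExt Kb Ka ω (k - μ.2.2 + μ.1) * wExt Kb Ka ω (k - μ.2.2 + μ.2.1))) :=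
        Finset.sum_congr rfl fun i₁ _ => Finset.sum_congr rfl fun i₂ _ => Finset.sum_congr rfl fun μ _ =>
          key i₁ i₂ μ
    _ = 2 * R * ∑ i₁ : Fin m, ∑ i₂ : Fin m, ∑ μ ∈ 𝕊, |α i₁ i₂ i μ| * (1 + ε₀) ^ ((5 : ℝ) * (k - μ.2.2) / 2) *
          (wExt Kb Ka ω (k - μ.2.2 + μ.1) * wExt Kb Ka ω (k - μ.2.2 + μ.2.1)) := by
        simp only [Finset.mul_sum]
    _ ≤ 2 * R * (b * ω k) := mul_le_mul_of_nonneg_left (hB i k hk1 hk2) (by positivity)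
    _ = 2 * b * R * ω k := by ring

/-- **THE ANALYTIC ONE-STEP CERTIFICATE** (see the module docstring).
[cite: Tao2016AveragedNS, §4 Lemma 4.1 (4.8) (local existence for the quadratic nonlinearity); cell certificate format, majorant step] -/
theorem stepCert_of_majorant (hKb : 0 ≤ Kb) (hKa : 1 ≤ Ka) (hε : 0 < 1 + ε₀) (hω : ∀ k, 0 < ω k)
    {M : ℤ → ℝ} {t : ℕ → ℝ} {Node Hull : ℕ → (Fin m → ℤ → ℝ) → Prop} {j : ℕ}
    {b m₀ R δ A : ℝ} (hb : 0 ≤ b) (hm₀ : 0 ≤ m₀) (hδ : 0 ≤ δ)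
    (hh : 0 ≤ t (j + 1) - t j) (hguard : b * m₀ * (t (j + 1) - t j) < 1)
    (hB : ∀ i k, -Kb ≤ k → k ≤ Ka →
      ∑ i₁ : Fin m, ∑ i₂ : Fin m, ∑ μ ∈ 𝕊,
        |α i₁ i₂ i μ| * (1 + ε₀) ^ ((5 : ℝ) * (k - μ.2.2) / 2) *
          (wExt Kb Ka ω (k - μ.2.2 + μ.1) * wExt Kb Ka ω (k - μ.2.2 + μ.2.1)) ≤ b * ω k)
    (hN : ∀ y, Node j y → ∀ i k, -Kb ≤ k → k ≤ Ka → |y i k| ≤ m₀ * ω k)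
    (hR : m₀ / (1 - b * m₀ * (t (j + 1) - t j)) ≤ R) (hMR : ∀ k, -Kb ≤ k → k ≤ Ka → M k ≤ R * ω k)
    (hdef : InputDefectOn 𝕊 ε₀ α Kb Ka Eb Et ω (fun _ k => -(R * ω k)) (fun _ k => R * ω k) δ)
    (hA : gronwallBound 0 (2 * b * R) δ (t (j + 1) - t j) ≤ A)
    (hH : ∀ y : Fin m → ℤ → ℝ,
      (∀ i k, -Kb ≤ k → k ≤ Ka → |y i k| ≤ (m₀ / (1 - b * m₀ * (t (j + 1) - t j)) + A) * ω k) → Hull j y)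
    (hN' : ∀ y : Fin m → ℤ → ℝ,
      (∀ i k, -Kb ≤ k → k ≤ Ka → |y i k| ≤ (m₀ / (1 - b * m₀ * (t (j + 1) - t j)) + A) * ω k) →
        Node (j + 1) y) :
    StepCert 𝕊 ε₀ α Kb Ka Eb Et M t Node Hull j := by
  set h := t (j + 1) - t j with hhdef
  set m₁ := m₀ / (1 - b * m₀ * h) with hm₁
  have hden : 0 < 1 - b * m₀ * h := by linarith
  have hm₁0 : 0 ≤ m₁ := div_nonneg hm₀ hden.le
  have hR0 : 0 ≤ R := hm₁0.trans hR
  have hK : 0 ≤ 2 * b * R := by positivity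
  -- the majorant bound along `[0,h]` is below `m₁`
  have hmaj : ∀ u ∈ Icc 0 h, m₀ / (1 - b * m₀ * u) ≤ m₁ := by
    intro u hu
    have hdu : 0 < 1 - b * m₀ * u := by nlinarith [mul_nonneg hb hm₀, hu.2]
    exact div_le_div_of_nonneg_left hm₀ hden (by nlinarith [mul_nonneg hb hm₀, hu.2])
  refine stepCert_of_flowStep (Nlo := fun _ k => -(m₀ * ω k)) (Nhi := fun _ k => m₀ * ω k)
    (N'lo := fun _ k => -(m₁ * ω k)) (N'hi := fun _ k => m₁ * ω k)
    (Hlo := fun _ k => -(m₁ * ω k)) (Hhi := fun _ k => m₁ * ω k)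
    (glo := fun _ k => -(R * ω k)) (ghi := fun _ k => R * ω k)
    hKb hKa hω hK hδ (fun y hy i k hk1 hk2 => abs_le.mp (hN y hy i k hk1 hk2))
    (fun i k hk1 hk2 => ?_) (fun i k hk1 hk2 => ?_) (fieldLipOn_ball hε hω hR0 hB) hdef (fun z hz => ?_) hA
    (fun y hy => hH y fun i k hk1 hk2 => ?_) (fun y hy => hN' y fun i k hk1 hk2 => ?_)
  · -- the `M`-box inside the region
    have := hMR k hk1 hk2
    have hM0 : -(R * ω k) ≤ -M k := by linarith
    exact ⟨hM0, this⟩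
  · -- the hull inside the region
    have : m₁ * ω k ≤ R * ω k := mul_le_mul_of_nonneg_right hR (hω k).le
    exact ⟨by linarith, this⟩
  · -- the exact truncated flow from `z`, with the majorant enclosure
    have hz' : ∀ i k, -Kb ≤ k → k ≤ Ka → |z i k| ≤ m₀ * ω k := fun i k hk1 hk2 => abs_le.mpr (hz i k hk1 hk2)
    obtain ⟨ψ, hψ0, hψd, hψb⟩ := exists_truncFlow_majorant (𝕊 := 𝕊) (ε₀ := ε₀) (α := α) hKb hKa hε hω hb hB
      hm₀ hz' hh hguard
    refine ⟨ψ, hψ0, hψd, fun u hu i k hk1 hk2 => ?_, fun i k hk1 hk2 => ?_⟩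
    · have h1 := hψb u hu i k hk1 hk2
      have h2 : m₀ / (1 - b * m₀ * u) * ω k ≤ m₁ * ω k := mul_le_mul_of_nonneg_right (hmaj u hu) (hω k).le
      simp only [slice_apply]
      exact abs_le.mp (h1.trans h2)
    · have h1 := hψb h ⟨hh, le_rfl⟩ i k hk1 hk2
      have h2 : m₀ / (1 - b * m₀ * h) * ω k ≤ m₁ * ω k := mul_le_mul_of_nonneg_right (hmaj h ⟨hh, le_rfl⟩) (hω k).le
      simp only [slice_apply]
      exact abs_le.mp (h1.trans h2)
  · have := hy i k hk1 hk2
    rw [abs_le]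
    constructor <;> nlinarith [this.1, this.2, (hω k).le]
  · have := hy i k hk1 hk2
    rw [abs_le]
    constructor <;> nlinarith [this.1, this.2, (hω k).le]

end CertificateGlueOn

end Summit.NavierStokesRegularity.NavierStokesRegularity.Theorems

end
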